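import Literature.AlgebraicGeometry.Resolution.HilbertSamuelLocal
import Literature.AlgebraicGeometry.Resolution.ResolutionGlue
import Mathlib.AlgebraicGeometry.Morphisms.Proper
import Mathlib.AlgebraicGeometry.Limits
import Mathlib.AlgebraicGeometry.Noetherian
import HarnessLib

/-!
# Route `HilbertSamuelElimination`, crux `SigmaMaxModificationsCorridor3`
# (stmt-ResolutionOfSingularities-19249; child of `SigmaMaxModifications` stmt-…-18506),
# line `tame_wild` v3 (confined form) — MERGING TWO LOCAL `ν`-WITNESSES WITH DISJOINT TRACES

[OURS · L1 W4.2] The gluing engine of the CONFINED architecture (lead's H4F decision): local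
`ν`-witnesses over opens `U₁, …, U_r` of `X` whose traces on the stratum `X(ν)` are pairwise
disjoint glue, two at a time. A witness over the open `U` is taken in STRUCTURE-MAP form — a morphism
`a : Y → X` with image in `U`, proper locally over `U`, `Y` locally Noetherian and reduced of
dimension `≤ d` and `≤ N`, an isomorphism over `U ∩ Zc` (`Zc` an open, in applications `X ∖ X(ν)`),
pulling dense opens inside `X ∖ X(ν)` back to dense opens, `H^N` non-increasing, `ν ∉ Σ_Y(N)` — so
that the merge is SHAPE-PRESERVING and can be iterated:

* `exists_localWitness_sup` — witnesses over `U₁`, `U₂` with `U₁ ∩ U₂ ⊆ Zc` merge to a witness over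
  `U₁ ∪ U₂`: the pushout of `Y₁ ↩ a₁⁻¹(U₂) ≅ a₂⁻¹(U₁) ↪ Y₂` (both are open immersions onto
  `U₁ ∩ U₂ ⊆ X`, over which the two witnesses are isomorphisms), Stacks 01JA/01LH; every clause is
  checked on the two open charts `Y₁, Y₂ → P`, whose ranges are `a⁻¹(U₁)`, `a⁻¹(U₂)`.

The identity witness, the passage to `NuMod` and the one- and two-witness corollaries are in the
companion file `…Corridor3NuGluingFinite.lean`. This file does not import the route file. NOT a
statement of any manuscript. Pushout bookkeeping adapted from the landed
`Theorems/HilbertSamuelEliminationSigmaMaxModificationsCorridor3TameWildNuGluing.lean` (private there).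

## Sources

* The Stacks Project, Tags 01JA (gluing schemes), 01LH (gluing morphisms), 02I4. [StacksProject]
* V. Cossart, U. Jannsen, S. Saito, LNM 2270 (2020), Def. 2.28, Def. 6.14, Rem. 6.24.
  [CossartJannsenSaito2020]
-/

set_option linter.dupNamespace false -- mandated namespace of this single-conjunct summit

noncomputable section

open CategoryTheory CategoryTheory.Limits AlgebraicGeometry TopologicalSpace Topology
open Literature.AlgebraicGeometry.Resolution Literature.RingTheory.HilbertSamuel

namespace Summit.ResolutionOfSingularities.ResolutionOfSingularities.Theorems.SigmaMaxModificationsCorridor3.TameWild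

universe u

/-! ## Pushouts of two open immersions (adapted from the landed ν-gluing file, private there) -/

section Pushout

variable {W Y Z : Scheme.{u}} (f : W ⟶ Y) (g : W ⟶ Z) [IsOpenImmersion f] [IsOpenImmersion g]

/-- The first structure map of the pushout of two open immersions is an open immersion
(Mathlib's locally directed gluing, Stacks 01JA). [cite: StacksProject, Tag 01JA] -/
private theorem isOpenImmersion_pushoutInl' : IsOpenImmersion (pushout.inl f g) :=
  inferInstanceAs (IsOpenImmersion (colimit.ι (span f g) WalkingSpan.left))

/-- The second structure map of the pushout of two open immersions is an open immersion.
[cite: StacksProject, Tag 01JA] -/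
private theorem isOpenImmersion_pushoutInr' : IsOpenImmersion (pushout.inr f g) :=
  inferInstanceAs (IsOpenImmersion (colimit.ι (span f g) WalkingSpan.right))

/-- The two structure maps of the pushout of two open immersions are jointly surjective.
[cite: StacksProject, Tag 01JA] -/
private theorem pushout_cases' (x : ↑(pushout f g)) :
    (∃ y : Y, pushout.inl f g y = x) ∨ (∃ z : Z, pushout.inr f g z = x) := by
  obtain ⟨j, xj, h⟩ := Scheme.IsLocallyDirected.ι_jointly_surjective (span f g) x
  rcases j with _ | _ | _
  · left
    refine ⟨f xj, ?_⟩
    rw [← h, ← colimit.w (span f g) WalkingSpan.Hom.fst, Scheme.Hom.comp_apply]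
    rfl
  · exact Or.inl ⟨xj, h⟩
  · exact Or.inr ⟨xj, h⟩

/-- The pushout of two open immersions out of an open of a locally Noetherian scheme, into locally
Noetherian schemes, is locally Noetherian (it is covered by the components). [cite: StacksProject, Tag 01JA] -/
private theorem isLocallyNoetherian_pushout [IsLocallyNoetherian W] [IsLocallyNoetherian Y]
    [IsLocallyNoetherian Z] : IsLocallyNoetherian (pushout f g) := by
  refine (isLocallyNoetherian_iff_openCover (Scheme.IsLocallyDirected.openCover (span f g))).mpr ?_
  intro j
  rcases j with _ | _ | _
  · exact inferInstanceAs (IsLocallyNoetherian W)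
  · exact inferInstanceAs (IsLocallyNoetherian Y)
  · exact inferInstanceAs (IsLocallyNoetherian Z)

end Pushout

/-! ## Elementary facts about open immersions over `X` -/

/-- A scheme covered by two open immersions from reduced schemes is reduced. [folklore] -/
private theorem isReduced_of_jointly_surjective' {X' Y Z : Scheme.{u}} [IsReduced Y] [IsReduced Z]
    (inl : Y ⟶ X') (inr : Z ⟶ X') [IsOpenImmersion inl] [IsOpenImmersion inr]
    (h : ∀ x' : X', (∃ y, inl y = x') ∨ (∃ z, inr z = x')) : IsReduced X' := by
  have key : ∀ x' : X', _root_.IsReduced (X'.presheaf.stalk x') := by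
    intro x'
    rcases h x' with ⟨y, rfl⟩ | ⟨z, rfl⟩
    · exact isReduced_of_injective _ (asIso <| inl.stalkMap y).commRingCatIsoToRingEquiv.injective
    · exact isReduced_of_injective _ (asIso <| inr.stalkMap z).commRingCatIsoToRingEquiv.injective
  exact isReduced_of_isReduced_stalk _

/-- `dim S ≤ n` iff every point has coheight `≤ n` in the specialisation order. [folklore] -/
private theorem topologicalKrullDim_le_iff_coheight_le' (S : Scheme.{u}) (n : ℕ) :
    topologicalKrullDim S ≤ n ↔ ∀ s : S, Order.coheight s ≤ n := by
  have h : topologicalKrullDim S = Order.krullDim S :=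
    Order.krullDim_eq_of_orderIso (irreducibleSetEquivPoints (α := S))
  rw [h, Order.krullDim_eq_iSup_coheight, iSup_le_iff]
  exact forall_congr' fun s => by exact_mod_cast Iff.rfl

/-- A scheme covered by two open immersions from schemes of dimension `≤ n` has dimension `≤ n`
(Stacks 02I4). [cite: StacksProject, Tag 02I4] -/
private theorem topologicalKrullDim_le_of_jointly_surjective' {X' Y Z : Scheme.{u}} {n : ℕ}
    (inl : Y ⟶ X') (inr : Z ⟶ X') [IsOpenImmersion inl] [IsOpenImmersion inr]
    (h : ∀ x' : X', (∃ y, inl y = x') ∨ (∃ z, inr z = x'))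
    (hY : topologicalKrullDim Y ≤ n) (hZ : topologicalKrullDim Z ≤ n) :
    topologicalKrullDim X' ≤ n := by
  rw [topologicalKrullDim_le_iff_coheight_le'] at hY hZ ⊢
  intro x'
  rcases h x' with ⟨y, rfl⟩ | ⟨z, rfl⟩
  · rw [coheight_eq_of_isOpenImmersion]
    exact hY y
  · rw [coheight_eq_of_isOpenImmersion]
    exact hZ z

/-- Open immersions preserve the Hilbert–Samuel function (Noetherian hypothesis on the source).
[cite: CossartJannsenSaito2020, Def. 2.28] -/
private theorem hsFun_eq_of_isOpenImmersion'' {X Y : Scheme.{u}} (f : X ⟶ Y)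
    [IsLocallyNoetherian X] [IsOpenImmersion f] (N : ℕ) (x : X) :
    Scheme.hsFun X N x = Scheme.hsFun Y N (f x) := by
  rw [Scheme.hsFun, Scheme.hsFun, Scheme.hsPhi_eq_of_isIso_stalkMap f N x]
  exact hilbertSamuelFun_eq_of_ringEquiv
    (asIso (f.stalkMap x)).commRingCatIsoToRingEquiv.symm _

/-- **Restriction transfer along an open chart.** If `j : Y₁ → P` is an open immersion over `X`
(`j ≫ a = a₁`) whose range contains `a⁻¹(O)`, then `a₁ ∣ O` and `a ∣ O` are isomorphic arrows; in
particular every isomorphism-invariant property passes from one to the other. [folklore] -/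
private theorem morphismRestrict_iff_of_openImmersion (P : MorphismProperty Scheme.{u})
    [P.RespectsIso] {Y₁ X' X : Scheme.{u}} (j : Y₁ ⟶ X') [IsOpenImmersion j] (a : X' ⟶ X)
    (a₁ : Y₁ ⟶ X) (hj : j ≫ a = a₁) (O : X.Opens)
    (hr : ∀ x' : X', a x' ∈ O → ∃ y, j y = x') :
    P (a₁ ∣_ O) ↔ P (a ∣_ O) := by
  subst hj
  -- `j ∣ (a⁻¹ O) : (j ≫ a)⁻¹ O → a⁻¹ O` is a surjective open immersion, hence an isomorphism
  have hsurj : Function.Surjective (j ∣_ (a ⁻¹ᵁ O)).base := by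
    rintro ⟨x', hx'⟩
    obtain ⟨y, rfl⟩ := hr x' hx'
    exact ⟨⟨y, hx'⟩, Subtype.ext (morphismRestrict_base_coe j (a ⁻¹ᵁ O) ⟨y, hx'⟩)⟩
  haveI : Epi (j ∣_ (a ⁻¹ᵁ O)).base := (TopCat.epi_iff_surjective _).mpr hsurj
  have hI : IsIso (j ∣_ (a ⁻¹ᵁ O)) := IsOpenImmersion.isIso _
  have hcomp : (j ≫ a) ∣_ O = (j ∣_ (a ⁻¹ᵁ O)) ≫ (a ∣_ O) := morphismRestrict_comp j a O
  rw [hcomp]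
  exact @MorphismProperty.cancel_left_of_respectsIso _ _ P _ _ _ _ _ _ hI

/-! ## The two-chart merge -/

/-- **MERGING TWO LOCAL `ν`-WITNESSES WITH DISJOINT TRACES** (structure-map form; Stacks 01JA/01LH).
Let `X` be locally Noetherian, `Zc ⊆ X` an open (in applications `X ∖ X(ν)`), and `U₁, U₂` opens
with `U₁ ∩ U₂ ⊆ Zc`. Suppose `aᵢ : Yᵢ → X` (`i = 1, 2`) has image in `Uᵢ`, is proper locally over
`Uᵢ`, `Yᵢ` locally Noetherian and reduced of dimension `≤ d` and `≤ N`, `aᵢ` an isomorphism over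
`Uᵢ ∩ Zc`, pulling dense opens of `X` inside `Zcˢ := X ∖ X(ν)` back to dense opens, `H^N`
non-increasing, `ν ∉ Σ_{Yᵢ}(N)`. Then the pushout of `Y₁ ↩ a₁⁻¹(U₂) ≅ a₂⁻¹(U₁) ↪ Y₂` — both are open
immersions onto `U₁ ∩ U₂`, since `aᵢ` is an isomorphism over `U₁ ∩ U₂ ⊆ Uᵢ ∩ Zc` — is a witness of
the same shape over `U₁ ∪ U₂` (all clauses are checked on the two open charts `Y₁, Y₂ → P`, whose
ranges are `a⁻¹(U₁)`, `a⁻¹(U₂)`). [cite: StacksProject, Tag 01LH]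
[cite: CossartJannsenSaito2020, Def. 6.14, Rem. 6.24] -/
theorem exists_localWitness_sup (X : Scheme.{u}) (N d : ℕ) (ν : ℕ → ℕ) (Zc U₁ U₂ : X.Opens)
    (h12 : U₁ ⊓ U₂ ≤ Zc)
    (Y₁ : Scheme.{u}) (a₁ : Y₁ ⟶ X) (hn₁ : IsLocallyNoetherian Y₁) (hr₁ : ∀ y, a₁ y ∈ U₁)
    (hp₁ : ∀ x ∈ U₁, ∃ W : X.Opens, x ∈ W ∧ IsProper (a₁ ∣_ W)) (hred₁ : IsReduced Y₁)
    (hd₁ : topologicalKrullDim Y₁ ≤ (d : WithBot ℕ∞)) (hN₁ : topologicalKrullDim Y₁ ≤ (N : WithBot ℕ∞))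
    (hiso₁ : IsIso (a₁ ∣_ (U₁ ⊓ Zc)))
    (hdense₁ : ∀ V : X.Opens, Dense (V : Set X) → (V : Set X) ⊆ (Scheme.hsStratum X N ν)ᶜ →
      Dense ((a₁ ⁻¹ᵁ V : Y₁.Opens) : Set Y₁))
    (hmono₁ : ∀ y : Y₁, Scheme.hsFun Y₁ N y ≤ Scheme.hsFun X N (a₁ y))
    (hkill₁ : ν ∉ Scheme.hsValues Y₁ N)
    (Y₂ : Scheme.{u}) (a₂ : Y₂ ⟶ X) (hn₂ : IsLocallyNoetherian Y₂) (hr₂ : ∀ y, a₂ y ∈ U₂)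
    (hp₂ : ∀ x ∈ U₂, ∃ W : X.Opens, x ∈ W ∧ IsProper (a₂ ∣_ W)) (hred₂ : IsReduced Y₂)
    (hd₂ : topologicalKrullDim Y₂ ≤ (d : WithBot ℕ∞)) (hN₂ : topologicalKrullDim Y₂ ≤ (N : WithBot ℕ∞))
    (hiso₂ : IsIso (a₂ ∣_ (U₂ ⊓ Zc)))
    (hdense₂ : ∀ V : X.Opens, Dense (V : Set X) → (V : Set X) ⊆ (Scheme.hsStratum X N ν)ᶜ →
      Dense ((a₂ ⁻¹ᵁ V : Y₂.Opens) : Set Y₂))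
    (hmono₂ : ∀ y : Y₂, Scheme.hsFun Y₂ N y ≤ Scheme.hsFun X N (a₂ y))
    (hkill₂ : ν ∉ Scheme.hsValues Y₂ N) :
    ∃ (Y : Scheme.{u}) (a : Y ⟶ X), IsLocallyNoetherian Y ∧ (∀ y, a y ∈ U₁ ⊔ U₂) ∧
      (∀ x ∈ U₁ ⊔ U₂, ∃ W : X.Opens, x ∈ W ∧ IsProper (a ∣_ W)) ∧ IsReduced Y ∧
      topologicalKrullDim Y ≤ (d : WithBot ℕ∞) ∧ topologicalKrullDim Y ≤ (N : WithBot ℕ∞) ∧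
      IsIso (a ∣_ ((U₁ ⊔ U₂) ⊓ Zc)) ∧
      (∀ V : X.Opens, Dense (V : Set X) → (V : Set X) ⊆ (Scheme.hsStratum X N ν)ᶜ →
        Dense ((a ⁻¹ᵁ V : Y.Opens) : Set Y)) ∧
      (∀ y : Y, Scheme.hsFun Y N y ≤ Scheme.hsFun X N (a y)) ∧
      ν ∉ Scheme.hsValues Y N := by
  haveI := hn₁
  haveI := hn₂
  haveI := hred₁
  haveI := hred₂
  -- the common open `U₁ ∩ U₂`, seen in `Y₁` and in `Y₂`
  -- `jᵢ : aᵢ⁻¹(U_{3-i}) → X` is an open immersion with range `U₁ ∩ U₂`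
  have hle₁ : a₁ ⁻¹ᵁ U₂ ≤ a₁ ⁻¹ᵁ (U₁ ⊓ Zc) := fun y hy =>
    ⟨hr₁ y, h12 ⟨hr₁ y, hy⟩⟩
  have hle₂ : a₂ ⁻¹ᵁ U₁ ≤ a₂ ⁻¹ᵁ (U₂ ⊓ Zc) := fun y hy =>
    ⟨hr₂ y, h12 ⟨hy, hr₂ y⟩⟩
  set j₁ : ((a₁ ⁻¹ᵁ U₂ : Y₁.Opens) : Scheme.{u}) ⟶ X := (a₁ ⁻¹ᵁ U₂).ι ≫ a₁ with hj₁
  set j₂ : ((a₂ ⁻¹ᵁ U₁ : Y₂.Opens) : Scheme.{u}) ⟶ X := (a₂ ⁻¹ᵁ U₁).ι ≫ a₂ with hj₂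
  have hj₁' : j₁ = Y₁.homOfLE hle₁ ≫ (a₁ ∣_ (U₁ ⊓ Zc)) ≫ (U₁ ⊓ Zc).ι := by
    rw [hj₁, morphismRestrict_ι, Scheme.homOfLE_ι_assoc]
  have hj₂' : j₂ = Y₂.homOfLE hle₂ ≫ (a₂ ∣_ (U₂ ⊓ Zc)) ≫ (U₂ ⊓ Zc).ι := by
    rw [hj₂, morphismRestrict_ι, Scheme.homOfLE_ι_assoc]
  haveI : IsOpenImmersion j₁ := by
    rw [hj₁']
    haveI := hiso₁
    infer_instance
  haveI : IsOpenImmersion j₂ := by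
    rw [hj₂']
    haveI := hiso₂
    infer_instance
  have hsurj₁ : ∀ x : X, x ∈ U₁ ⊓ Zc → ∃ y : Y₁, a₁ y = x := by
    intro x hx
    haveI := hiso₁
    obtain ⟨v, hv⟩ := (a₁ ∣_ (U₁ ⊓ Zc)).surjective ⟨x, hx⟩
    exact ⟨v.1, by rw [← morphismRestrict_base_coe a₁ (U₁ ⊓ Zc) v, hv]⟩
  have hsurj₂ : ∀ x : X, x ∈ U₂ ⊓ Zc → ∃ y : Y₂, a₂ y = x := by
    intro x hx
    haveI := hiso₂
    obtain ⟨v, hv⟩ := (a₂ ∣_ (U₂ ⊓ Zc)).surjective ⟨x, hx⟩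
    exact ⟨v.1, by rw [← morphismRestrict_base_coe a₂ (U₂ ⊓ Zc) v, hv]⟩
  have hrange₁ : Set.range j₁.base = ((U₁ ⊓ U₂ : X.Opens) : Set X) := by
    ext x
    constructor
    · rintro ⟨w, rfl⟩
      show a₁ ((a₁ ⁻¹ᵁ U₂).ι w) ∈ U₁ ⊓ U₂
      rw [Scheme.Opens.ι_apply]
      exact ⟨hr₁ _, w.2⟩
    · rintro ⟨hx₁, hx₂⟩
      obtain ⟨y, rfl⟩ := hsurj₁ x ⟨hx₁, h12 ⟨hx₁, hx₂⟩⟩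
      exact ⟨⟨y, hx₂⟩, rfl⟩
  have hrange₂ : Set.range j₂.base = ((U₁ ⊓ U₂ : X.Opens) : Set X) := by
    ext x
    constructor
    · rintro ⟨w, rfl⟩
      show a₂ ((a₂ ⁻¹ᵁ U₁).ι w) ∈ U₁ ⊓ U₂
      rw [Scheme.Opens.ι_apply]
      exact ⟨w.2, hr₂ _⟩
    · rintro ⟨hx₁, hx₂⟩
      obtain ⟨y, rfl⟩ := hsurj₂ x ⟨hx₂, h12 ⟨hx₁, hx₂⟩⟩
      exact ⟨⟨y, hx₁⟩, rfl⟩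
  -- identify the two copies of `U₁ ∩ U₂`
  set e := IsOpenImmersion.isoOfRangeEq j₁ j₂ (hrange₁.trans hrange₂.symm) with he
  have hej : e.hom ≫ j₂ = j₁ := IsOpenImmersion.isoOfRangeEq_hom_fac _ _ _
  set i₁ : ((a₁ ⁻¹ᵁ U₂ : Y₁.Opens) : Scheme.{u}) ⟶ Y₁ := (a₁ ⁻¹ᵁ U₂).ι with hi₁
  set i₂ : ((a₁ ⁻¹ᵁ U₂ : Y₁.Opens) : Scheme.{u}) ⟶ Y₂ := e.hom ≫ (a₂ ⁻¹ᵁ U₁).ι with hi₂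
  haveI : IsOpenImmersion i₂ := by rw [hi₂]; infer_instance
  have hcompat : i₁ ≫ a₁ = i₂ ≫ a₂ := by
    rw [hi₂, Category.assoc, ← hj₂, hej]
  -- the pushout and its structure map to `X`
  haveI := isOpenImmersion_pushoutInl' i₁ i₂
  haveI := isOpenImmersion_pushoutInr' i₁ i₂
  refine ⟨pushout i₁ i₂, pushout.desc a₁ a₂ hcompat, isLocallyNoetherian_pushout i₁ i₂, ?_⟩
  set P := pushout i₁ i₂ with hP
  set a : P ⟶ X := pushout.desc a₁ a₂ hcompat with ha
  set inl : Y₁ ⟶ P := pushout.inl i₁ i₂ with hinl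
  set inr : Y₂ ⟶ P := pushout.inr i₁ i₂ with hinr
  have hal : inl ≫ a = a₁ := pushout.inl_desc _ _ _
  have har : inr ≫ a = a₂ := pushout.inr_desc _ _ _
  have hal' : ∀ y, a (inl y) = a₁ y := fun y => by rw [← Scheme.Hom.comp_apply, hal]
  have har' : ∀ y, a (inr y) = a₂ y := fun y => by rw [← Scheme.Hom.comp_apply, har]
  have hcases : ∀ p : P, (∃ y, inl y = p) ∨ (∃ z, inr z = p) := pushout_cases' i₁ i₂
  -- ranges of the charts: `range inl = a⁻¹(U₁)`, `range inr = a⁻¹(U₂)`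
  have hrl : ∀ p : P, a p ∈ U₁ → ∃ y, inl y = p := by
    intro p hp
    rcases hcases p with ⟨y, rfl⟩ | ⟨z, rfl⟩
    · exact ⟨y, rfl⟩
    · rw [har'] at hp
      -- `z ∈ a₂⁻¹(U₁)` is hit by `i₂`
      obtain ⟨w, hw⟩ : ∃ w, i₂ w = z := by
        obtain ⟨w', hw'⟩ : ∃ w' : (a₂ ⁻¹ᵁ U₁ : Y₂.Opens), (a₂ ⁻¹ᵁ U₁).ι w' = z :=
          ⟨⟨z, hp⟩, rfl⟩
        refine ⟨e.inv w', ?_⟩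
        rw [hi₂, Scheme.Hom.comp_apply, ← Scheme.Hom.comp_apply e.inv e.hom, Iso.inv_hom_id]
        simpa using hw'
      exact ⟨i₁ w, by rw [← Scheme.Hom.comp_apply, pushout.condition, Scheme.Hom.comp_apply, hw]⟩
  have hrr : ∀ p : P, a p ∈ U₂ → ∃ z, inr z = p := by
    intro p hp
    rcases hcases p with ⟨y, rfl⟩ | ⟨z, rfl⟩
    · rw [hal'] at hp
      exact ⟨i₂ ⟨y, hp⟩, by
        rw [← Scheme.Hom.comp_apply, ← pushout.condition, Scheme.Hom.comp_apply]; rfl⟩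
    · exact ⟨z, rfl⟩
  refine ⟨fun p => ?_, fun x hx => ?_, isReduced_of_jointly_surjective' inl inr hcases,
    topologicalKrullDim_le_of_jointly_surjective' inl inr hcases hd₁ hd₂,
    topologicalKrullDim_le_of_jointly_surjective' inl inr hcases hN₁ hN₂, ?_, ?_, ?_, ?_⟩
  · -- image in `U₁ ∪ U₂`
    rcases hcases p with ⟨y, rfl⟩ | ⟨z, rfl⟩
    · rw [hal']; exact Opens.mem_sup.mpr (Or.inl (hr₁ y))
    · rw [har']; exact Opens.mem_sup.mpr (Or.inr (hr₂ z))
  · -- proper locally over `U₁ ∪ U₂`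
    rcases Opens.mem_sup.mp hx with hx | hx
    · obtain ⟨W, hxW, hW⟩ := hp₁ x hx
      refine ⟨W ⊓ U₁, ⟨hxW, hx⟩, ?_⟩
      have hW' : IsProper (a₁ ∣_ (W ⊓ U₁)) := by
        have e' := morphismRestrictRestrict a₁ W ((W).ι ⁻¹ᵁ U₁)
        haveI := hW
        have h1 : IsProper (a₁ ∣_ W ∣_ (W.ι ⁻¹ᵁ U₁)) := inferInstance
        have h2 := ((MorphismProperty.arrow_mk_iso_iff @IsProper e').mp h1)
        have hV : W.ι ''ᵁ (W.ι ⁻¹ᵁ U₁) = W ⊓ U₁ := by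
          rw [Scheme.Hom.image_preimage_eq_opensRange_inf, Scheme.Opens.opensRange_ι]
        exact ((MorphismProperty.arrow_mk_iso_iff @IsProper (morphismRestrictEq a₁ hV))).mp h2
      exact (morphismRestrict_iff_of_openImmersion @IsProper inl a a₁ hal (W ⊓ U₁)
        (fun p hp => hrl p hp.2)).mp hW'
    · obtain ⟨W, hxW, hW⟩ := hp₂ x hx
      refine ⟨W ⊓ U₂, ⟨hxW, hx⟩, ?_⟩
      have hW' : IsProper (a₂ ∣_ (W ⊓ U₂)) := by
        have e' := morphismRestrictRestrict a₂ W ((W).ι ⁻¹ᵁ U₂)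
        haveI := hW
        have h1 : IsProper (a₂ ∣_ W ∣_ (W.ι ⁻¹ᵁ U₂)) := inferInstance
        have h2 := ((MorphismProperty.arrow_mk_iso_iff @IsProper e').mp h1)
        have hV : W.ι ''ᵁ (W.ι ⁻¹ᵁ U₂) = W ⊓ U₂ := by
          rw [Scheme.Hom.image_preimage_eq_opensRange_inf, Scheme.Opens.opensRange_ι]
        exact ((MorphismProperty.arrow_mk_iso_iff @IsProper (morphismRestrictEq a₂ hV))).mp h2
      exact (morphismRestrict_iff_of_openImmersion @IsProper inr a a₂ har (W ⊓ U₂)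
        (fun p hp => hrr p hp.2)).mp hW'
  · -- isomorphism over `(U₁ ∪ U₂) ∩ Zc = (U₁ ∩ Zc) ∪ (U₂ ∩ Zc)`
    have h1 : IsIso (a ∣_ (U₁ ⊓ Zc)) :=
      (morphismRestrict_iff_of_openImmersion (MorphismProperty.isomorphisms Scheme.{u}) inl a a₁
        hal (U₁ ⊓ Zc) (fun p hp => hrl p hp.1)).mp hiso₁
    have h2 : IsIso (a ∣_ (U₂ ⊓ Zc)) :=
      (morphismRestrict_iff_of_openImmersion (MorphismProperty.isomorphisms Scheme.{u}) inr a a₂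
        har (U₂ ⊓ Zc) (fun p hp => hrr p hp.1)).mp hiso₂
    have h12' : (U₁ ⊔ U₂) ⊓ Zc = (U₁ ⊓ Zc) ⊔ (U₂ ⊓ Zc) := inf_sup_right U₁ U₂ Zc
    rw [h12']
    exact isIso_morphismRestrict_sup a h1 h2
  · -- dense opens inside `X ∖ X(ν)` pull back to dense opens: check on the two charts
    intro V hVd hV
    rw [dense_iff_closure_eq, Set.eq_univ_iff_forall]
    have hinlV : inl.base '' ((a₁ ⁻¹ᵁ V : Y₁.Opens) : Set Y₁) ⊆ ((a ⁻¹ᵁ V : P.Opens) : Set P) := by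
      rintro _ ⟨y', hy', rfl⟩
      show a (inl y') ∈ V
      rw [hal' y']
      exact hy'
    have hinrV : inr.base '' ((a₂ ⁻¹ᵁ V : Y₂.Opens) : Set Y₂) ⊆ ((a ⁻¹ᵁ V : P.Opens) : Set P) := by
      rintro _ ⟨y', hy', rfl⟩
      show a (inr y') ∈ V
      rw [har' y']
      exact hy'
    intro p
    rcases hcases p with ⟨y, rfl⟩ | ⟨z, rfl⟩
    · have h1 : inl.base '' closure ((a₁ ⁻¹ᵁ V : Y₁.Opens) : Set Y₁) ⊆
          closure (inl.base '' ((a₁ ⁻¹ᵁ V : Y₁.Opens) : Set Y₁)) :=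
        image_closure_subset_closure_image inl.continuous
      have h3 : inl y ∈ inl.base '' closure ((a₁ ⁻¹ᵁ V : Y₁.Opens) : Set Y₁) :=
        ⟨y, by rw [(hdense₁ V hVd hV).closure_eq]; exact Set.mem_univ y, rfl⟩
      exact closure_mono hinlV (h1 h3)
    · have h1 : inr.base '' closure ((a₂ ⁻¹ᵁ V : Y₂.Opens) : Set Y₂) ⊆
          closure (inr.base '' ((a₂ ⁻¹ᵁ V : Y₂.Opens) : Set Y₂)) :=
        image_closure_subset_closure_image inr.continuous
      have h3 : inr z ∈ inr.base '' closure ((a₂ ⁻¹ᵁ V : Y₂.Opens) : Set Y₂) :=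
        ⟨z, by rw [(hdense₂ V hVd hV).closure_eq]; exact Set.mem_univ z, rfl⟩
      exact closure_mono hinrV (h1 h3)
  · -- `H^N` is non-increasing
    intro p
    rcases hcases p with ⟨y, rfl⟩ | ⟨z, rfl⟩
    · rw [← hsFun_eq_of_isOpenImmersion'' inl N y, hal' y]
      exact hmono₁ y
    · rw [← hsFun_eq_of_isOpenImmersion'' inr N z, har' z]
      exact hmono₂ z
  · -- `ν` is not a value upstairs
    rintro ⟨p, hp⟩
    rcases hcases p with ⟨y, rfl⟩ | ⟨z, rfl⟩
    · exact hkill₁ ⟨y, by rw [hsFun_eq_of_isOpenImmersion'' inl N y, hp]⟩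
    · exact hkill₂ ⟨z, by rw [hsFun_eq_of_isOpenImmersion'' inr N z, hp]⟩

end Summit.ResolutionOfSingularities.ResolutionOfSingularities.Theorems.SigmaMaxModificationsCorridor3.TameWild

end
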